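import Summits.PneNP.PneNP.Theses.SzkEntropy
import Literature.Computability.Complexity.PolynomialEntropyApproximation
import Literature.Computability.Complexity.PromiseBPPClosureProofs
import Literature.InformationTheory.Entropy.LinearMapEntropy

/-!
# Polar *-algebra linearization — the CHECKED RUNG of a line that does NOT conclude the crux

Crux `stmt-PneNP-10778` = `Summit.PneNP.PneNP.Theses.SzkEntropy.PeaTwoMemBPP` (`PEA 2 ∈ PromiseBPP'`),
idea card `Cruxes/PeaTwoMemBPP/Ideas/polar-star-algebra-linearization.md` (ideator 3, triage r1: pass ×3).
Author: planner-cruxplan-stmt-PneNP-10778-polar-star-algebra-l-0, 2026-08-16 (crux-plan seat).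

**Verdict of the crux-plan seat: `no-skeleton`.**  This file is NOT a `Lines/<slug>.lean` skeleton: it has no
`PeaTwoMemBPP_of`.  It records, kernel-checked, (A) the statements the line genuinely delivers — a
fixed-parameter rung of the crux, "entropy approximation of quadratic maps over `F₂` is FPT in the entropy
threshold `k`" (`stub_*` below, each a support-grade lemma/theorem-candidate; `sorry` only there) — and (B) the
reason no concluding skeleton exists: the only stub that could cover the complement of the rung is a
residual-class membership `PEAResidual 2 c ∈ PromiseBPP'`, and `residual_iff_crux` PROVES it is equivalent to
the crux itself modulo the one-gadget padding reduction `PaddingReduction` (on paper: direct product with the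
quadratic bijection `x ↦ x³` of `F_{2^N}`, `N` odd) — i.e. COSTUME in the sense of the crux protocol; while the
genericity/inverse-theorem alternatives (the card's "(n,m,CP)-Poisson law", the merged card's K1) are refuted on
paper by triage §X (squared syndrome maps).  See `Lines/polar-star-algebra-linearization.md` for the argument.

Contents
* `polar` — polarization `B(x,h) = q(x+h) + q(x) + q(h) + q(0)` of a map `q : F₂ⁿ → F₂ᵐ`.
* `stub_polarRank` — F₂ analogue of DGRV Lemma 5.1: `rank B(·,h) ≤ 2·H(q(Uₙ))` for every direction `h`.
* `stub_translationPeel` — exact peeling identity `H(q) = dim φ(U) + H(q mod φ(U))` when `q(x+u) = q(x) + φ(u)`.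
* `stub_shrunkPairUpper` — a shrunk pair `(U,E)` (q affine modulo `E` on `U`-cosets) bounds `H(q)` above by
  `codim U + rank(φ|U mod E) + dim E`.
* `stub_rankDoublingLog` — UNCONDITIONAL rank doubling over `F₂` with a log factor (field extension of degree
  `s = 2·log₂(r+1)+3`, β-linear expansion `crk_K ≤ s·crk_{F₂}`, max-rank-element shrunk pair over `K` when
  `|K| ≥ crk_K + 2`, Galois descent of the canonical optimal shrunk subspace): every bilinear
  `B : F₂ⁿ × F₂ⁿ → F₂ᵐ` whose slices `B(·,h)` all have rank `≤ r` has a shrunk pair of cost `≤ (4·log₂(r+1)+6)·r`.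
  `KPrime` — the sharp conjectural form (cost `≤ 2r`; tight on diagonal simplex-code spaces, triage r1-1/3).
* `PEALow d c`, `PEALowLog d c` — `PEA d` restricted to thresholds `k ≤ c·log₂|x|`, resp. `k·(log₂ k + 1) ≤ c·log₂|x|`.
  `stub_lowEntropyBPP : ∀ c, PEALowLog 2 c ∈ PromiseBPP'` — THE RUNG (unconditional);
  `stub_logThreshold_of_KPrime : KPrime → ∀ c, PEALow 2 c ∈ PromiseBPP'`.
* `linCost`, `PEAResidual d c`, `PaddingReduction c`, `residual_iff_crux` — the costume certificate (B).
-/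

set_option linter.dupNamespace false

namespace Summit.PneNP.PneNP.Cruxes.PeaTwoMemBPP.PolarStarAlgebraLinearization

open Literature.InformationTheory.Entropy Literature.Computability.Complexity Finset
open Summit.PneNP.PneNP.Theses.SzkEntropy (PeaTwoMemBPP)

variable {n m : ℕ}

/-! ## The object: polarization of a map `F₂ⁿ → F₂ᵐ` -/

/-- Polarization `B(x,h) = q(x+h) + q(x) + q(h) + q(0)` (characteristic 2).  For a quadratic map it is bilinear,
symmetric, alternating, and `{B(·,h) : h}` is the ADJOINT PENCIL `𝓜_q` of the card. [DGRV 2010, §5] -/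
def polar (q : (Fin n → ZMod 2) → (Fin m → ZMod 2)) (x h : Fin n → ZMod 2) : Fin m → ZMod 2 :=
  q (x + h) + q x + q h + q 0

/-! ## (A) The rung: statements the line delivers (support grade; `sorry` = to be proved by provers) -/

/-- **F₂ analogue of DGRV Lemma 5.1** (card First lemma; triage r1 ×3: true).  If `x ↦ B(x,h)` is a linear map
`L` then `rank L ≤ 2·H(q(Uₙ))`: `L(X)` is uniform on `range L` (entropy `= finrank`,
`mapEntropy_univ_linearMap_zmod_two`) and is a function of the pair `(q(X+h), q(X))`, each of entropy `H`.
Consequence: `crk_{F₂}(𝓜_q) ≤ 2H`. Size M. -/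
theorem stub_polarRank (q : (Fin n → ZMod 2) → (Fin m → ZMod 2)) (h : Fin n → ZMod 2)
    (L : (Fin n → ZMod 2) →ₗ[ZMod 2] (Fin m → ZMod 2)) (hL : ∀ x, L x = polar q x h) :
    (Module.finrank (ZMod 2) (LinearMap.range L) : ℝ) ≤ 2 * mapEntropy Finset.univ q := by
  sorry

open scoped Classical in
/-- **Exact translation peeling** (card; radical case of the `(U,E)`-identity).  If `q(x+u) = q(x) + φ(u)` for all
`x` and all `u ∈ U` then the output law is uniform on `φ(U)`-cosets and `H(q) = dim φ(U) + H(π_{φ(U)} ∘ q)`: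
an exact reduction to fewer output dimensions, no sampling, no loss.  Size M. -/
theorem stub_translationPeel (q : (Fin n → ZMod 2) → (Fin m → ZMod 2))
    (U : Submodule (ZMod 2) (Fin n → ZMod 2)) (φ : (Fin n → ZMod 2) →ₗ[ZMod 2] (Fin m → ZMod 2))
    (hU : ∀ x, ∀ u ∈ U, q (x + u) = q x + φ u) :
    mapEntropy Finset.univ q =
      Module.finrank (ZMod 2) (U.map φ) + mapEntropy Finset.univ (fun x => (U.map φ).mkQ (q x)) := by
  sorry

/-- **Shrunk-pair upper bound** (affine form of the merged card's `mapEntropy_le_of_shrunk_pair`).  If `q` is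
AFFINE MODULO `E` ON `U`-COSETS — `q(x+u) − q(x) − φ(u) ∈ E` for `u ∈ U` (this is what a shrunk pair
`B(U,F₂ⁿ) ⊆ E` of the polarization gives, with `φ(u) = q(u) + q(0)`) — then `q` takes at most
`2^{codim U} · 2^{rank(U → F₂ᵐ/E)} · 2^{dim E}` values, so `H(q) ≤ (n − dim U) + dim((U.map φ) mod E) + dim E`;
stated with the cruder middle term `finrank (U.map φ)`.  Size S/M. -/
theorem stub_shrunkPairUpper (q : (Fin n → ZMod 2) → (Fin m → ZMod 2))
    (U : Submodule (ZMod 2) (Fin n → ZMod 2)) (E : Submodule (ZMod 2) (Fin m → ZMod 2))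
    (φ : (Fin n → ZMod 2) →ₗ[ZMod 2] (Fin m → ZMod 2))
    (hq : ∀ x, ∀ u ∈ U, q (x + u) - q x - φ u ∈ E) :
    mapEntropy Finset.univ q ≤
      ((n : ℝ) - Module.finrank (ZMod 2) U) + Module.finrank (ZMod 2) (U.map φ)
        + Module.finrank (ZMod 2) E := by
  sorry

/-- **Unconditional rank doubling over `F₂`, log factor** (sharpening of triage r1-2's remark; planner's
derivation in the line card §3): for a bilinear `B : F₂ⁿ →ₗ F₂ⁿ →ₗ F₂ᵐ` all of whose slices `B(·,h) = B.flip h`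
have rank `≤ r` there is a shrunk pair — `U ≤ F₂ⁿ`, `E ≤ F₂ᵐ` with `B(U, F₂ⁿ) ⊆ E` — of cost
`(n − dim U) + dim E ≤ (4·log₂(r+1) + 6)·r`.  Proof sketch: over `K = F_{2^s}`, `s = 2·Nat.log2 (r+1) + 3`, every
`K`-combination of slices is `Σ_j β_j N_j` with `N_j` in the `F₂`-span, so `crk_K ≤ s·r =: r'`; `2^s ≥ r' + 2`, so a
slice `A` of maximal rank `r'` satisfies `N(ker A) ⊆ im A` for every `N` in the pencil (the `(r'+1)`-minor of
`A + tN` is a nonzero polynomial of degree `≤ r'+1` in `t`), giving the `K`-pair `(ker A, im A)` of cost `2r'`; the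
cost functional is submodular, optimal shrunk subspaces form a Galois-stable lattice, and its least element
descends to `F₂` [IvanyosQiaoSubrahmanyam2018 (arXiv:1512.03531) §1.1; FortinReutenauer2004].  Size M/L. -/
theorem stub_rankDoublingLog
    (B : (Fin n → ZMod 2) →ₗ[ZMod 2] (Fin n → ZMod 2) →ₗ[ZMod 2] (Fin m → ZMod 2)) (r : ℕ)
    (hr : ∀ h, Module.finrank (ZMod 2) (LinearMap.range (B.flip h)) ≤ r) :
    ∃ (U : Submodule (ZMod 2) (Fin n → ZMod 2)) (E : Submodule (ZMod 2) (Fin m → ZMod 2)),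
      (∀ u ∈ U, ∀ h, B u h ∈ E) ∧
      (n - Module.finrank (ZMod 2) U) + Module.finrank (ZMod 2) E ≤ (4 * Nat.log2 (r + 1) + 6) * r := by
  sorry

/-- **Conjecture K′** (card; Fortin–Reutenauer's `ncrk ≤ 2·crk` over `F₂`, bilinear/rectangular form): the shrunk
pair can be taken of cost `≤ 2r`.  Tight infinitely often (diagonal simplex-code spaces: `ncrk = 2·crk − 1`,
triage r1-1/r1-3); checked exhaustively on 3×3 pairs and on ~1.9·10⁵ small spaces (kit j007245, j007618, j007619),
no violation.  A CONJECTURE, not a stub: recorded as a `Prop` only. -/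
def KPrime : Prop :=
  ∀ (n m : ℕ) (B : (Fin n → ZMod 2) →ₗ[ZMod 2] (Fin n → ZMod 2) →ₗ[ZMod 2] (Fin m → ZMod 2)) (r : ℕ),
    (∀ h, Module.finrank (ZMod 2) (LinearMap.range (B.flip h)) ≤ r) →
    ∃ (U : Submodule (ZMod 2) (Fin n → ZMod 2)) (E : Submodule (ZMod 2) (Fin m → ZMod 2)),
      (∀ u ∈ U, ∀ h, B u h ∈ E) ∧
      (n - Module.finrank (ZMod 2) U) + Module.finrank (ZMod 2) E ≤ 2 * r

/-- `PEA d` restricted to LOGARITHMIC thresholds: instances `(n, p, k)` with `k ≤ c · log₂ |encoding|`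
(yes/no conditions as in `PEA d`). [DGRV 2010, §3 (PEA); this restriction: the card's delivered regime] -/
noncomputable def PEALow (d c : ℕ) : PromiseProblem :=
  PromiseProblem.ofEncoding PEAInst.encoding
    {I | PolyMapF2.DegLE d I.2.1 ∧ (I.2.2 : ℝ) + 1 ≤ PolyMapF2.entropy I.2.1 ∧
      I.2.2 ≤ c * Nat.log2 (PEAInst.encoding.encode I).length}
    {I | PolyMapF2.DegLE d I.2.1 ∧ PolyMapF2.entropy I.2.1 ≤ (I.2.2 : ℝ) ∧
      I.2.2 ≤ c * Nat.log2 (PEAInst.encoding.encode I).length}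

/-- `PEA d` restricted to thresholds with `k · (log₂ k + 1) ≤ c · log₂ |encoding|` — the slice on which the
unconditional `2^{O(k log k)} · poly` evaluator is polynomial. -/
noncomputable def PEALowLog (d c : ℕ) : PromiseProblem :=
  PromiseProblem.ofEncoding PEAInst.encoding
    {I | PolyMapF2.DegLE d I.2.1 ∧ (I.2.2 : ℝ) + 1 ≤ PolyMapF2.entropy I.2.1 ∧
      I.2.2 * (Nat.log2 I.2.2 + 1) ≤ c * Nat.log2 (PEAInst.encoding.encode I).length}
    {I | PolyMapF2.DegLE d I.2.1 ∧ PolyMapF2.entropy I.2.1 ≤ (I.2.2 : ℝ) ∧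
      I.2.2 * (Nat.log2 I.2.2 + 1) ≤ c * Nat.log2 (PEAInst.encoding.encode I).length}

/-- **THE RUNG (unconditional): `PEA₂` is fixed-parameter tractable in the threshold.**  For every `c`, the slice
`PEALowLog 2 c` is in textbook promise-BPP.  Algorithm (card + `stub_rankDoublingLog`): rename unused variables
away; compute by IQS (deterministic polynomial time, any field) an optimal shrunk pair `(U,E)` of the
polarization, cost `κ₁`; if `κ₁ > (4·log₂(2k+1)+6)·2k` answer YES (`stub_polarRank` + `stub_rankDoublingLog` give
`κ₁ ≤ (4 log₂(2H+1)+6)·2H`, so `H > k`, hence `H ≥ k+1` on the promise); else run the `(U,E)`-mixture evaluator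
(exact enumeration of the `2^{codim U}` cosets, affine part exact by `stub_translationPeel`-type identities,
`E`-part by empirical histograms on `2^{dim E}` cells, Hoeffding) to precision `1/4` in time
`poly(|x|) · 2^{O(κ₁)} = poly(|x|) · 2^{O(k log k)} = poly(|x|)` on the slice, and compare with `k + 1/2`.
Why it might fail: only formalisation size (IQS in `FP`, the sampling analysis); mathematically each step is a
theorem or a printed algorithm [IvanyosQiaoSubrahmanyam2018 Thm 1.5; DGRV 2010 Lemma 5.1]. Size XL (machine). -/
theorem stub_lowEntropyBPP : ∀ c : ℕ, PEALowLog 2 c ∈ PromiseBPP' := by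
  sorry

/-- **The rung under K′**: logarithmic thresholds outright (`κ₁ ≤ 4H`, evaluator `2^{O(k)} · poly`). -/
theorem stub_logThreshold_of_KPrime : KPrime → ∀ c : ℕ, PEALow 2 c ∈ PromiseBPP' := by
  sorry

/-! ## (B) Why there is no concluding skeleton: the residual stub would be the crux in costume -/

/-- The vector form of a sparse map's evaluation (coordinate `i < m = P.length` of `P.eval x`). -/
def vecEval (P : PolyMapF2 n) (x : Fin n → ZMod 2) : Fin P.length → ZMod 2 :=
  fun i => (P.eval x).getD i 0

/-- **Linearisation cost** `κ₁(P)`: the least `codim U + dim E` over pairs with `B_P(U, F₂ⁿ) ⊆ E`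
(`= ncrk`-cost of the adjoint pencil; `U = ⊥, E = ⊥` shows the set is nonempty, so `κ₁ ≤ n`). -/
noncomputable def linCost (P : PolyMapF2 n) : ℕ :=
  sInf {t : ℕ | ∃ (U : Submodule (ZMod 2) (Fin n → ZMod 2)) (E : Submodule (ZMod 2) (Fin P.length → ZMod 2)),
    (∀ u ∈ U, ∀ x, polar (vecEval P) x u ∈ E) ∧ t = (n - Module.finrank (ZMod 2) U) + Module.finrank (ZMod 2) E}

/-- The RESIDUAL of the structure half: `PEA d` restricted to instances the `2^{O(κ₁)}` evaluator cannot afford,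
`κ₁(p) > c · log₂ |encoding|`. -/
noncomputable def PEAResidual (d c : ℕ) : PromiseProblem :=
  PromiseProblem.ofEncoding PEAInst.encoding
    {I | PolyMapF2.DegLE d I.2.1 ∧ (I.2.2 : ℝ) + 1 ≤ PolyMapF2.entropy I.2.1 ∧
      c * Nat.log2 (PEAInst.encoding.encode I).length < linCost I.2.1}
    {I | PolyMapF2.DegLE d I.2.1 ∧ PolyMapF2.entropy I.2.1 ≤ (I.2.2 : ℝ) ∧
      c * Nat.log2 (PEAInst.encoding.encode I).length < linCost I.2.1}

/-- **Padding reduction** (on paper, elementary; the costume witness): `PEA 2` Karp-reduces to its own residual.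
Map `(n, q, k) ↦ (n + N, q × g_N, k + N)` with `g_N` the coordinate form of `x ↦ x³ = x²·x` on `F_{2^N}`
(`x ↦ x²` is `F₂`-linear, so `g_N` is QUADRATIC with `≤ N³` monomials), `N` the least odd number with
`N − 1 > c · log₂ |new encoding|` (`N = O(c log |x|)`): `gcd(3, 2^N − 1) = 1` so `g_N` is a bijection and
`H(q × g_N) = H(q) + N` exactly (`entropy_prod`), thresholds shift by the integer `N`, degree stays `≤ 2`; and
`κ₁(q × g_N) ≥ κ₁(g_N) ≥ N − 1` because `κ₁` is additive over direct products (block-diagonal pencils) and every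
nonzero `u ∈ F_{2^N}` has `dim B_{g}(u, F_{2^N}) = dim {u²h + uh²} = N − 1`.  Recorded as a `Prop` (the `FP`
formalisation of the gadget is routine but long); NOT used by part (A). -/
def PaddingReduction (c : ℕ) : Prop :=
  (PEA 2).PolyTimeReducible (PEAResidual 2 c)

/-- The residual's instance sets are subsets of `PEA 2`'s. [folklore] -/
theorem PEAResidual_yes_le (c : ℕ) : (PEAResidual 2 c).yes ≤ (PEA 2).yes :=
  PEAInst.encoding.toLanguage_mono fun _ hI => ⟨hI.1, hI.2.1⟩

/-- The residual's instance sets are subsets of `PEA 2`'s. [folklore] -/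
theorem PEAResidual_no_le (c : ℕ) : (PEAResidual 2 c).no ≤ (PEA 2).no :=
  PEAInst.encoding.toLanguage_mono fun _ hI => ⟨hI.1, hI.2.1⟩

/-- Textbook promise-BPP is antitone in the promise (same witness language and coin polynomial).
[Goldreich 2006, §1.2] -/
theorem mem_PromiseBPP'_anti {Q Q' : PromiseProblem} (hy : Q.yes ≤ Q'.yes) (hn : Q.no ≤ Q'.no)
    (h : Q' ∈ PromiseBPP') : Q ∈ PromiseBPP' := by
  obtain ⟨L', hL', p, hyes, hno⟩ := h
  exact ⟨L', hL', p, fun x hx => hyes x (hy hx), fun x hx => hno x (hn hx)⟩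

/-- **Costume certificate.**  Modulo the padding reduction, "the residual is in promise-BPP" is EQUIVALENT to the
crux: a skeleton `structure half + (PEAResidual 2 c ∈ PromiseBPP') ⟹ PeaTwoMemBPP` would carry a stub that
restates the crux (forbidden), and the structure half would remove no difficulty from it.  (`→`: closure of
`PromiseBPP'` under Karp reductions, PROVED in the tree; `←`: the crux is `PEA 2 ∈ PromiseBPP'` by `Iff.rfl` and
the residual is a sub-promise.) -/
theorem residual_iff_crux (c : ℕ) (hpad : PaddingReduction c) :
    PEAResidual 2 c ∈ PromiseBPP' ↔ PeaTwoMemBPP := by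
  constructor
  · intro h
    show PEA 2 ∈ PromiseBPP'
    exact PromiseProblem.mem_PromiseBPP'_of_polyTimeReducible_holds' hpad h
  · intro h
    have h2 : PEA 2 ∈ PromiseBPP' := h
    exact mem_PromiseBPP'_anti (PEAResidual_yes_le c) (PEAResidual_no_le c) h2

/-- For the record: the rung IS a consequence of the crux (sub-promise), so filing it as SUPPORT on route
SzkEntropy is consistent — it is strictly weaker and provable now. -/
theorem lowEntropy_of_crux (h : PeaTwoMemBPP) (c : ℕ) : PEALowLog 2 c ∈ PromiseBPP' := by
  have h2 : PEA 2 ∈ PromiseBPP' := h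
  refine mem_PromiseBPP'_anti ?_ ?_ h2
  · exact PEAInst.encoding.toLanguage_mono fun _ hI => ⟨hI.1, hI.2.1⟩
  · exact PEAInst.encoding.toLanguage_mono fun _ hI => ⟨hI.1, hI.2.1⟩

end Summit.PneNP.PneNP.Cruxes.PeaTwoMemBPP.PolarStarAlgebraLinearization
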